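import Summits.AtomisticToContinuum.BoseEinsteinCondensation.Theorems.BECStronglyRayleighLatticeToPeriodicBridgeMuffinTinDefs
import Literature.MathematicalPhysics.QuantumManyBody.BoseGasPaddingStates

/-!
# Route `BECStronglyRayleigh`, crux `LatticeToPeriodicBridge` (stmt-AtomisticToContinuum-9674),
# line `muffin-tin-reward-supermodularity` — WELL PACKING: finite-energy states living in the wells

Helper file of the crux line `muffin-tin-reward-supermodularity` (lead prover-line-stmt-AtomisticToContinuum-9674-c2-0,
`--supports stmt-AtomisticToContinuum-9674`), the geometric input of the DOWN direction for stub S1a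
(`…MuffinTinDeepWallsDepleteOfFloor.lean` needs ONE periodic trial state `Φ` with `⟨W⟩_Φ = 0` and `E_v[Φ] < ⊤`, so that
`E(λ,0) ≤ E_v[Φ]` uniformly in the wall height `λ`).

`DownSandwich.exists_state_in_wells_dilute` (= registered sub-goal `downSandwich_wellPacking`): for a measurable profile
`v` vanishing beyond `R₀`, wall fraction `0 < w < 1`, `M ≥ 1` periods of the torus of side `L > 0` with period
`L/M ≥ 8·max(R₀,1)/(1-w)`, and `N ≤ (1-w)³L³/(64·max(R₀,1)³)` particles (a density cap only, `M ≥ 1` arbitrary — the typed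
geometry of `DeepWallGerm`; many particles per well), such a `Φ` exists.

Construction (Ruelle 1969 §3.5.11 as formalised in `BoseGasThermodynamicLimitRuelle` / `BoseGasPaddingStates`): a
Dirichlet `SupportedState` on a union of `N` cells `subBox ℓ (ℓ+s) d` (`s = max(R₀,1)`) of ONE cubic lattice at distinct
digits has energy `≤ N·E₀^D(1,ℓ) < ⊤` (`infEnergy_biUnion_le`, one bump per cell); the lattice has pitch `p = b/m`,
`b = L/M`, `m = ⌊b/(2s)⌋` (commensurate with the muffin tin), and the digits `u ↦ (u/c)·m + j₀ + u % c` (`j₀ = ⌊wm⌋+1`,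
`c = m - j₀ ≥ (1-w)b/(4s)` good residues) place every cell inside an open well cube `((q+w)b, (q+1)b)³`, `q < M`, and
inside the box `Λ_{L-s}`; the state is then a Dirichlet `TrialState N (L-s)`, periodised by `TrialState.toPeriodic`. On the
cell the periodised state IS the Dirichlet state, which vanishes unless every particle is in a well, where
`fract(Mx_k/L) ∈ (w,1)`, so `⟨W⟩ = 0`; its periodic energy is at most the Dirichlet energy because the padding `s ≥ R₀`
kills the image interactions (`TrialState.periodicEnergy_toPeriodic_le`).

References: Ruelle 1969 §3.5.11 (subadditivity over separated cells); LSSY2005 Ch. 2 (periodisation of Dirichlet states).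
-/

noncomputable section

namespace Summit.AtomisticToContinuum.BoseEinsteinCondensation.Cruxes.LatticeToPeriodicBridge.MuffinTinRewardSupermodularity

open MeasureTheory Filter
open scoped ENNReal NNReal Topology
open Literature.MathematicalPhysics.QuantumManyBody.BoseGas
open Summit.AtomisticToContinuum.BoseEinsteinCondensation.Theses
open Summit.AtomisticToContinuum.BoseEinsteinCondensation.Theses.BECStronglyRayleigh

namespace DownSandwich

variable {N : ℕ} {L : ℝ}

/-- `fract t = t - d` on `(d + w, d + 1)` for a natural `d` and `w > 0`, hence `¬ fract t < w` there. [folklore] -/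
theorem not_fract_lt_of_mem {t w : ℝ} {d : ℕ} (hw : 0 < w) (h1 : (d : ℝ) + w < t) (h2 : t < (d : ℝ) + 1) :
    ¬ Int.fract t < w := by
  have hfr : Int.fract t = t - d := by
    rw [Int.fract_eq_iff]
    refine ⟨by linarith, by linarith, ⟨(d : ℤ), ?_⟩⟩
    push_cast
    ring
  rw [hfr, not_lt]
  linarith

/-- `u ↦ (u / c)·m + j₀ + u % c` is injective on `ℕ` when `0 < c` and `j₀ + c ≤ m`. [folklore] -/
theorem digit_injective {m c j₀ : ℕ} (hc : 0 < c) (hcm : j₀ + c ≤ m) :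
    Function.Injective fun u : ℕ => u / c * m + j₀ + u % c := by
  intro u u' h
  simp only at h
  have hm : 0 < m := lt_of_lt_of_le (Nat.lt_of_lt_of_le hc (Nat.le_add_left c j₀)) hcm
  have hlt : ∀ u : ℕ, j₀ + u % c < m := fun u => lt_of_lt_of_le (Nat.add_lt_add_left (Nat.mod_lt u hc) j₀) hcm
  have hdiv : ∀ u : ℕ, (u / c * m + j₀ + u % c) / m = u / c := fun u => by
    rw [add_assoc, Nat.add_comm, Nat.add_mul_div_right _ _ hm, Nat.div_eq_of_lt (hlt u), zero_add]
  have hmod : ∀ u : ℕ, (u / c * m + j₀ + u % c) % m = j₀ + u % c := fun u => by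
    rw [add_assoc, Nat.add_comm, Nat.add_mul_mod_self_right, Nat.mod_eq_of_lt (hlt u)]
  have h1 : u / c = u' / c := by rw [← hdiv u, ← hdiv u', h]
  have h2 : u % c = u' % c := by
    have := hmod u
    rw [h, hmod u'] at this
    omega
  rw [← Nat.div_add_mod u c, ← Nat.div_add_mod u' c, h1, h2]

/-- **Well packing (dilute, many particles per well).** For a measurable profile `v` vanishing beyond `R₀`, wall
fraction `0 < w < 1`, `M ≥ 1` periods of the torus of side `L > 0` with period `L/M ≥ 8·max(R₀,1)/(1-w)`, and
`N ≤ (1-w)³ L³ / (64·max(R₀,1)³)` particles, there is a periodic trial state living in the wells (`⟨W⟩ = 0`) with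
finite periodic energy: one Dirichlet bump per cell of a sub-lattice of pitch `p = (L/M)/m ≥ 2·max(R₀,1)` commensurate
with the muffin tin, using only the cells inside the wells (Ruelle's subadditivity over separated sub-boxes, then
periodisation; the padding `max(R₀,1)` kills the image interactions). [folklore] -/
theorem exists_state_in_wells_dilute {v : ℝ → ℝ≥0∞} {R₀ : ℝ} (hv : Measurable v)
    (hvR : ∀ r, R₀ < r → v r = 0) {w : ℝ} (hw0 : 0 < w) (hw1 : w < 1) {M : ℕ} (hM : 0 < M) (hL : 0 < L)
    (hbig : 8 * max R₀ 1 / (1 - w) ≤ L / M)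
    (hN : (N : ℝ) ≤ (1 - w) ^ 3 / (64 * (max R₀ 1) ^ 3) * L ^ 3) :
    ∃ Φ : PeriodicTrialState N L, wallEnergy N L M w Φ.ψ = 0 ∧ periodicEnergy v Φ ≠ ⊤ := by
  classical
  -- lengths
  set s : ℝ := max R₀ 1 with hs
  have hs1 : 1 ≤ s := le_max_right _ _
  have hs0 : 0 < s := lt_of_lt_of_le one_pos hs1
  have hR₀s : R₀ ≤ s := le_max_left _ _
  set b : ℝ := L / M with hb
  have hM0 : (0 : ℝ) < M := by exact_mod_cast hM
  have hbpos : 0 < b := div_pos hL hM0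
  have h1w : 0 < 1 - w := by linarith
  have hLM : L = M * b := by rw [hb]; field_simp
  have hb8 : 8 * s / (1 - w) ≤ b := hbig
  have hb8' : 8 * s ≤ (1 - w) * b := by
    rw [div_le_iff₀ h1w] at hb8; linarith
  -- the sub-lattice: `m` cells of pitch `p = b/m` per period, the good residues `j₀ ≤ r < m`
  set m : ℕ := ⌊b / (2 * s)⌋₊ with hm
  have hm_le : (m : ℝ) ≤ b / (2 * s) := Nat.floor_le (by positivity)
  have hm_gt : b / (2 * s) - 1 < m := by
    have := Nat.lt_floor_add_one (b / (2 * s)); rw [← hm] at this; linarith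
  have hb2s : 4 ≤ b / (2 * s) := by
    rw [le_div_iff₀ (by positivity)]
    have : (1 - w) * b ≤ b := by nlinarith
    linarith
  have hm1 : (1 : ℝ) ≤ m := by linarith
  have hm_pos : 0 < m := by exact_mod_cast (show (0 : ℝ) < m by linarith)
  have hmR : (0 : ℝ) < m := by exact_mod_cast hm_pos
  set p : ℝ := b / m with hp
  have hp2s : 2 * s ≤ p := by
    rw [hp, le_div_iff₀ hmR]
    calc 2 * s * m ≤ 2 * s * (b / (2 * s)) := mul_le_mul_of_nonneg_left hm_le (by positivity)
      _ = b := by field_simp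
  have hppos : 0 < p := lt_of_lt_of_le (by positivity) hp2s
  have hmp : (m : ℝ) * p = b := by rw [hp]; field_simp
  set ℓ : ℝ := p - s with hℓ
  have hℓpos : 0 < ℓ := by rw [hℓ]; linarith
  have hℓs : ℓ + s = p := by rw [hℓ]; ring
  set j₀ : ℕ := ⌊w * m⌋₊ + 1 with hj₀
  have hj₀gt : w * m < j₀ := by
    have := Nat.lt_floor_add_one (w * m)
    rw [hj₀]; push_cast; linarith
  have hj₀le : (j₀ : ℝ) ≤ w * m + 1 := by
    rw [hj₀]; push_cast; linarith [Nat.floor_le (show 0 ≤ w * m by positivity)]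
  -- the number of good residues `c = m - j₀ ≥ (1-w) b / (4 s) ≥ 2`
  have hcR : (1 - w) * b / (4 * s) ≤ (m : ℝ) - j₀ := by
    have h1 : (1 - w) * b / (4 * s) = (1 - w) * (b / (2 * s)) - (1 - w) * b / (4 * s) := by
      field_simp; ring
    have h2 : 2 ≤ (1 - w) * b / (4 * s) := by
      rw [le_div_iff₀ (by positivity)]; linarith
    nlinarith
  have hc2 : (2 : ℝ) ≤ (m : ℝ) - j₀ := le_trans (by rw [le_div_iff₀ (by positivity)]; linarith) hcR
  have hj₀m : j₀ ≤ m := by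
    have : (j₀ : ℝ) ≤ m := by linarith
    exact_mod_cast this
  set c : ℕ := m - j₀ with hc
  have hcnat : ((c : ℕ) : ℝ) = (m : ℝ) - j₀ := by rw [hc, Nat.cast_sub hj₀m]
  have hc_pos : 0 < c := by
    have : (0 : ℝ) < c := by rw [hcnat]; linarith
    exact_mod_cast this
  have hjc : j₀ + c ≤ m := by omega
  -- capacity: `N ≤ (M c)³`
  set cap : ℕ := M * c with hcap
  have hcapR : (1 - w) * L / (4 * s) ≤ (cap : ℝ) := by
    rw [hcap, Nat.cast_mul, hcnat, hLM]
    calc (1 - w) * (M * b) / (4 * s) = M * ((1 - w) * b / (4 * s)) := by ring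
      _ ≤ M * ((m : ℝ) - j₀) := mul_le_mul_of_nonneg_left hcR hM0.le
  have hNcap : N ≤ cap ^ 3 := by
    have h1 : (N : ℝ) ≤ (cap : ℝ) ^ 3 := by
      refine hN.trans ?_
      calc (1 - w) ^ 3 / (64 * s ^ 3) * L ^ 3 = ((1 - w) * L / (4 * s)) ^ 3 := by
            field_simp; ring
        _ ≤ (cap : ℝ) ^ 3 := pow_le_pow_left₀ (by positivity) hcapR 3
    exact_mod_cast h1
  -- the digits of the `N` occupied cells
  let idx : Fin N → Fin 3 → Fin cap := fun j => finFunctionFinEquiv.symm (Fin.castLE hNcap j)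
  let dg : Fin N → Fin 3 → ℕ := fun j k => (idx j k : ℕ) / c * m + j₀ + (idx j k : ℕ) % c
  have hdg_inj : Function.Injective dg := by
    intro j j' h
    have h1 : idx j = idx j' := by
      funext k
      exact Fin.ext (digit_injective hc_pos hjc (congrFun h k))
    exact Fin.castLE_injective hNcap (finFunctionFinEquiv.symm.injective h1)
  -- each occupied cell lies in a well, inside the box `Λ_{L-s}`
  have hcell : ∀ j k, ∃ q : ℕ, q < M ∧ ((q : ℝ) + w) * b < p * (dg j k) ∧
      p * (dg j k) + ℓ < ((q : ℝ) + 1) * b ∧ p * (dg j k) + ℓ ≤ L - s := by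
    intro j k
    set u : ℕ := (idx j k : ℕ) with hu
    have hu_lt : u < M * c := (idx j k).isLt
    have hq : u / c < M := Nat.div_lt_of_lt_mul (by rwa [mul_comm] at hu_lt)
    have ht : u % c < c := Nat.mod_lt u hc_pos
    refine ⟨u / c, hq, ?_, ?_, ?_⟩
    · change ((u / c : ℕ) + w) * b < p * ((u / c * m + j₀ + u % c : ℕ) : ℝ)
      push_cast
      have h1 : w * b < p * j₀ := by
        calc w * b = w * m * p := by rw [← hmp]; ring
          _ < j₀ * p := mul_lt_mul_of_pos_right hj₀gt hppos
          _ = p * j₀ := mul_comm _ _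
      have h2 : (0 : ℝ) ≤ p * (u % c : ℕ) := by positivity
      calc ((u / c : ℕ) + w) * b = (u / c : ℕ) * (m * p) + w * b := by rw [hmp]; ring
        _ < (u / c : ℕ) * (m * p) + p * j₀ + p * (u % c : ℕ) := by linarith
        _ = p * ((u / c : ℕ) * m + j₀ + (u % c : ℕ)) := by ring
    · change p * ((u / c * m + j₀ + u % c : ℕ) : ℝ) + ℓ < ((u / c : ℕ) + 1) * b
      push_cast
      have h1 : ((j₀ : ℝ) + (u % c : ℕ) + 1) ≤ m := by
        have : j₀ + u % c + 1 ≤ m := by omega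
        exact_mod_cast this
      calc p * ((u / c : ℕ) * m + j₀ + (u % c : ℕ)) + ℓ
          < p * ((u / c : ℕ) * m + j₀ + (u % c : ℕ)) + p := by linarith [hs0]
        _ = (u / c : ℕ) * (m * p) + p * (j₀ + (u % c : ℕ) + 1) := by ring
        _ ≤ (u / c : ℕ) * (m * p) + p * m := by gcongr
        _ = ((u / c : ℕ) + 1) * b := by rw [← hmp]; ring
    · change p * ((u / c * m + j₀ + u % c : ℕ) : ℝ) + ℓ ≤ L - s
      push_cast
      have h1 : ((u / c : ℕ) : ℝ) * m + j₀ + (u % c : ℕ) + 1 ≤ M * m := by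
        have hq' : u / c + 1 ≤ M := hq
        have : u / c * m + j₀ + u % c + 1 ≤ M * m := by
          calc u / c * m + j₀ + u % c + 1 ≤ u / c * m + m := by omega
            _ = (u / c + 1) * m := by ring
            _ ≤ M * m := Nat.mul_le_mul_right m hq'
        exact_mod_cast this
      calc p * ((u / c : ℕ) * m + j₀ + (u % c : ℕ)) + ℓ
          = p * (((u / c : ℕ) : ℝ) * m + j₀ + (u % c : ℕ) + 1) - s := by rw [hℓ]; ring
        _ ≤ p * (M * m) - s := by gcongr
        _ = L - s := by rw [hLM, ← hmp]; ring
  -- the union of the occupied cells and a finite-energy Dirichlet state on it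
  set U : Set Space := ⋃ j ∈ (Finset.univ : Finset (Fin N)), subBox ℓ (ℓ + s) (dg j) with hU
  have hvs : ∀ r, s < r → v r = 0 := fun r hr => hvR r (lt_of_le_of_lt hR₀s hr)
  have hinf : infEnergy v N U < ⊤ := by
    have h := infEnergy_biUnion_le (ℓ := ℓ) hv hvs hs0.le (Finset.univ : Finset (Fin N)) dg
      (fun j _ j' _ hne heq => hne (hdg_inj heq)) (fun _ => 1)
    simp only [Finset.sum_const, Finset.card_univ, Fintype.card_fin, smul_eq_mul, mul_one] at h
    refine lt_of_le_of_lt h (ENNReal.sum_lt_top.2 fun j _ => ?_)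
    exact lt_of_le_of_lt (infEnergy_subBox_le_groundStateEnergy v 1 ℓ (ℓ + s) (dg j))
      (groundStateEnergy_one_lt_top v hℓpos)
  obtain ⟨Ψ, hΨ⟩ := iInf_lt_iff.1 hinf
  have hmemU : ∀ {x : Space}, x ∈ U → ∃ j, ∀ k, p * (dg j k) < x k ∧ x k < p * (dg j k) + ℓ := by
    intro x hx
    simp only [hU, Set.mem_iUnion, Finset.mem_univ, exists_true_left] at hx
    obtain ⟨j, hj⟩ := hx
    rw [mem_subBox, hℓs] at hj
    exact ⟨j, hj⟩
  have hUbox : U ⊆ box (L - s) := by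
    intro x hx k
    obtain ⟨j, hj⟩ := hmemU hx
    obtain ⟨q, -, hq1, -, hq3⟩ := hcell j k
    have : (0 : ℝ) < ((q : ℝ) + w) * b := by positivity
    constructor
    · linarith [(hj k).1]
    · linarith [(hj k).2]
  set ΨT : TrialState N (L - s) := (Ψ.mono hUbox).toTrialState with hΨT
  have hΨTψ : ΨT.ψ = Ψ.ψ := rfl
  have hLs : L - s ≤ L := by linarith
  refine ⟨ΨT.toPeriodic hL hLs, ?_, ?_⟩
  · -- no wall mass: on the cell the periodised state is the Dirichlet state, supported in the wells
    change ∫⁻ X in cellN N L, wallCount M L w X * ((‖periodize L ΨT.ψ X‖₊ : ℝ≥0∞)) ^ 2 = 0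
    refine (setLIntegral_congr_fun (measurableSet_cellN N L) fun X hX => ?_).trans lintegral_zero
    rw [periodize_of_mem_cellN hL _ hX, hΨTψ]
    by_cases hX0 : Ψ.ψ X = 0
    · simp [hX0]
    · have hin : ∀ i, X i ∈ U := fun i => by
        by_contra hi; exact hX0 (Ψ.eq_zero X ⟨i, hi⟩)
      have hW : wallCount M L w X = 0 := by
        unfold wallCount
        refine Finset.sum_eq_zero fun i _ => Finset.sum_eq_zero fun k _ => ?_
        obtain ⟨j, hj⟩ := hmemU (hin i)
        obtain ⟨q, -, hq1, hq2, -⟩ := hcell j k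
        have h1 : ((q : ℝ) + w) * b < X i k := lt_trans hq1 (hj k).1
        have h2 : X i k < ((q : ℝ) + 1) * b := lt_trans (hj k).2 hq2
        have ht1 : (q : ℝ) + w < (M : ℝ) * X i k / L := by
          rw [hLM, lt_div_iff₀ (by positivity)]
          calc ((q : ℝ) + w) * (M * b) = M * (((q : ℝ) + w) * b) := by ring
            _ < M * X i k := mul_lt_mul_of_pos_left h1 hM0
        have ht2 : (M : ℝ) * X i k / L < (q : ℝ) + 1 := by
          rw [hLM, div_lt_iff₀ (by positivity)]
          calc (M : ℝ) * X i k < M * (((q : ℝ) + 1) * b) := mul_lt_mul_of_pos_left h2 hM0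
            _ = ((q : ℝ) + 1) * (M * b) := by ring
        rw [if_neg (not_fract_lt_of_mem hw0 ht1 ht2)]
      rw [hW, zero_mul]
  · -- finite periodic energy (no image interactions thanks to the padding `s ≥ R₀`)
    refine ne_top_of_le_ne_top ?_ (ΨT.periodicEnergy_toPeriodic_le hvR hL hLs (by linarith))
    rw [energy_eq_rawEnergy, hΨTψ]
    exact hΨ.ne

end DownSandwich

/-- **Registered sub-goal `downSandwich_wellPacking`** (geometric input of the DOWN direction for `stub_deepWallGerm`):
in the typed geometry of `DeepWallGerm` — period `L/M ≥ 8·max(R₀,1)/(1-w)` and density `N ≤ (1-w)³L³/(64·max(R₀,1)³)`,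
`M ≥ 1` arbitrary — some periodic trial state lives in the wells of the muffin tin with finite periodic energy. [folklore] -/
theorem downSandwich_wellPacking :
    ∀ (v : ℝ → ENNReal) (R₀ : ℝ), Measurable v → (∀ r, R₀ < r → v r = 0) →
      ∀ (w : ℝ), 0 < w → w < 1 → ∀ (M : ℕ), 0 < M → ∀ (L : ℝ), 0 < L →
        8 * max R₀ 1 / (1 - w) ≤ L / M →
        ∀ (N : ℕ), (N : ℝ) ≤ (1 - w) ^ 3 / (64 * (max R₀ 1) ^ 3) * L ^ 3 →
          ∃ Φ : PeriodicTrialState N L, wallEnergy N L M w Φ.ψ = 0 ∧ periodicEnergy v Φ ≠ ⊤ :=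
  fun _ _ hv hvR _ hw0 hw1 _ hM _ hL hbig _ hN =>
    DownSandwich.exists_state_in_wells_dilute hv hvR hw0 hw1 hM hL hbig hN

end Summit.AtomisticToContinuum.BoseEinsteinCondensation.Cruxes.LatticeToPeriodicBridge.MuffinTinRewardSupermodularity

end
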